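import Mathlib
import Summits.AtomisticToContinuum.Crystallization.Theorems.ReggeStarCoercivityDefectFreeCrystallizesSqueezeToLayeredA
import HarnessLib

/-!
# Generic squeeze, clean centres and the laminar reading of a pinned window — line
`stacking-blind-budget-flatness`, crux `ChessboardParticlePlanes.LjLaminarWindows` (stmt-AtomisticToContinuum-6711)

Definition-free glue of the line's skeleton (`Cruxes/LjLaminarWindows/Lines/stacking_blind_budget_flatness.lean`,
lead a1), landed so that the skeleton shrinks to its registered stubs and a short composition:

* `gsqueeze_ineq`, `gsqueeze_tendsto_card_div` — VERBATIM the squeeze of line `prestress-split-korn`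
  (`PrestressSplitKorn.squeeze_ineq` / `squeeze_tendsto_card_not_layeredNear_div`, crux 13603) with the charged
  predicate `¬ LayeredNear η` replaced by an ARBITRARY site predicate `P`: a slack-coercive charge on `P`
  (charge `c` independent of the slack `θ`; depth `ρ` and boundary constant `C` after `θ`) together with the
  `o(N)` energy budget of Lennard-Jones ground states (`squeeze_tendsto_sum_excess_div`, where minimality is spent)
  and a vanishing defect fraction force the `P`-charged fraction to vanish.
* `eventually_exists_clean_centre` — packing: if the fraction of sites violating a predicate `Q` vanishes along a
  sequence of ground states, then for every radius `R'`, for all large `N`, some particle has every particle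
  within `R'` satisfying `Q` (verbatim `PrestressSplitKorn.squeeze_eventually_exists_centre` for a general `Q`).
* `laminar_of_pinnedMatching` — a particle-to-template matching of the closed `R`-ball of `x i` with a rigid
  image of a layered template `layeredPos a s z` whose height increments are `≥ 19/25` is, read through the
  inverse rotation, an `ε`-laminar window with `3/4`-separated heights (`sep_of_increments`: `19/25 ≥ 3/4`) — the
  one-window laminarity clause of the crux at `(L, η) = (R, ε)`.

No statement of the line is asserted here; nothing about ground states is assumed beyond the tree's budget.
-/

noncomputable section

open scoped BigOperators Classical
open Filter Topology

namespace Summit.AtomisticToContinuum.Crystallization.Theorems.StackingBlindBudgetFlatness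

open Literature.MathematicalPhysics.StatisticalMechanics Literature.Geometry.DiscreteGeometry
open Summit.AtomisticToContinuum.Crystallization.Theorems (ChargedEnergyGapNegative.eStar)
open Summit.AtomisticToContinuum.Crystallization.Theorems.PrestressSplitKorn
open Summit.AtomisticToContinuum.Crystallization.Theorems.DefectFreeCrystallizes.Negative.PredicateAPI
  (Good defects)


/-! ## The generic squeeze -/

section Squeeze

variable {N : ℕ}

/-- **The squeeze inequality for one configuration and one predicate.** If the slack-coercivity inequality
holds (charge `c`, boundary constant `C`, slack `θ ≥ 0`, depth `ρ`) for every set `Ω` whose `ρ`-neighbourhoods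
are good, then, applied to THE set of `ρ`-deep good sites, it bounds the number of ALL `P`-charged sites by the
total excess, the slack `θ·N` and a multiple of the number of defective sites. -/
theorem gsqueeze_ineq {δ c θ ρ C : ℝ} (hδ : 0 < δ) (hρ : 0 < ρ) (hc : 0 < c) (hθ : 0 ≤ θ)
    {x : Fin N → (EuclideanSpace ℝ (Fin 3))} (P : Fin N → Prop) [DecidablePred P]
    (hsep : ∀ i j : Fin N, i ≠ j → δ ≤ dist (x i) (x j))
    (hΩ : ∀ Ω : Finset (Fin N), (∀ i ∈ Ω, ∀ j : Fin N, dist (x j) (x i) ≤ ρ → Good x j) →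
      c * ((Ω.filter fun i => P i).card : ℝ)
          - C * ((Ω.filter fun i => ∃ j : Fin N, j ∉ Ω ∧ dist (x j) (x i) ≤ ρ).card : ℝ)
          - θ * (Ω.card : ℝ)
        ≤ ∑ i ∈ Ω, ((1 / 2 : ℝ) * siteEnergy lennardJones x i - ChargedEnergyGapNegative.eStar)) :
    c * ((Finset.univ.filter fun i => P i).card : ℝ) ≤
      (∑ i, ((1 / 2 : ℝ) * siteEnergy lennardJones x i - ChargedEnergyGapNegative.eStar)) + θ * N +
        (2 * ρ / δ + 1) ^ 3 * (max C 0 * (2 * ρ / δ + 1) ^ 3 +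
          (125 / 6 * δ⁻¹ ^ 6 + |ChargedEnergyGapNegative.eStar|) + c) *
          ((Finset.univ.filter fun i => ¬ Good x i).card : ℝ) := by
  set e : ℝ := ChargedEnergyGapNegative.eStar with he
  set M : ℝ := (2 * ρ / δ + 1) ^ 3 with hM
  set D := Finset.univ.filter fun i : Fin N => ¬ Good x i with hD
  set Ω := Finset.univ.filter fun i : Fin N => ∀ j : Fin N, dist (x j) (x i) ≤ ρ → Good x j
    with hΩdef
  have hgood : ∀ i ∈ Ω, ∀ j : Fin N, dist (x j) (x i) ≤ ρ → Good x j := fun i hi =>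
    (Finset.mem_filter.1 hi).2
  have hineq := hΩ Ω hgood
  have hM0 : 0 ≤ M := by positivity
  -- the shallow sites are within `ρ` of a defective site
  have hcompl : ((Ωᶜ).card : ℝ) ≤ M * D.card := by
    have hsub : Ωᶜ ⊆ Finset.univ.filter fun i : Fin N => ∃ j ∈ D, dist (x j) (x i) ≤ ρ := by
      intro i hi
      rw [Finset.mem_compl, hΩdef, Finset.mem_filter, not_and] at hi
      have h' := hi (Finset.mem_univ i)
      push Not at h'
      obtain ⟨j, hj, hjg⟩ := h'
      exact Finset.mem_filter.2
        ⟨Finset.mem_univ _, j, Finset.mem_filter.2 ⟨Finset.mem_univ _, hjg⟩, hj⟩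
    calc ((Ωᶜ).card : ℝ)
        ≤ ((Finset.univ.filter fun i : Fin N => ∃ j ∈ D, dist (x j) (x i) ≤ ρ).card : ℝ) := by
          exact_mod_cast Finset.card_le_card hsub
      _ ≤ M * D.card := squeeze_card_filter_exists_near_le hδ hρ.le hsep D
  -- the boundary layer of `Ω` is within `ρ` of the shallow sites
  have hbdry : ((Ω.filter fun i => ∃ j : Fin N, j ∉ Ω ∧ dist (x j) (x i) ≤ ρ).card : ℝ) ≤
      M * (M * D.card) := by
    have hsub : (Ω.filter fun i => ∃ j : Fin N, j ∉ Ω ∧ dist (x j) (x i) ≤ ρ) ⊆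
        Finset.univ.filter fun i : Fin N => ∃ j ∈ Ωᶜ, dist (x j) (x i) ≤ ρ := by
      intro i hi
      obtain ⟨-, j, hj, hji⟩ := Finset.mem_filter.1 hi
      exact Finset.mem_filter.2 ⟨Finset.mem_univ _, j, Finset.mem_compl.2 hj, hji⟩
    calc ((Ω.filter fun i => ∃ j : Fin N, j ∉ Ω ∧ dist (x j) (x i) ≤ ρ).card : ℝ)
        ≤ ((Finset.univ.filter fun i : Fin N => ∃ j ∈ Ωᶜ, dist (x j) (x i) ≤ ρ).card : ℝ) := by
          exact_mod_cast Finset.card_le_card hsub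
      _ ≤ M * (Ωᶜ).card := squeeze_card_filter_exists_near_le hδ hρ.le hsep Ωᶜ
      _ ≤ M * (M * D.card) := mul_le_mul_of_nonneg_left hcompl hM0
  -- the excess on `Ω` is at most the total excess plus `(B + |e*|)·#Ωᶜ`
  have hsum : ∑ i ∈ Ω, ((1 / 2 : ℝ) * siteEnergy lennardJones x i - e) ≤
      (∑ i, ((1 / 2 : ℝ) * siteEnergy lennardJones x i - e)) +
        (125 / 6 * δ⁻¹ ^ 6 + |e|) * (M * D.card) := by
    rw [← Finset.sum_add_sum_compl Ω (fun i => (1 / 2 : ℝ) * siteEnergy lennardJones x i - e)]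
    have hlow : ∀ i ∈ Ωᶜ, -(125 / 6 * δ⁻¹ ^ 6 + |e|) ≤ (1 / 2 : ℝ) * siteEnergy lennardJones x i - e := by
      intro i _
      have h1 := squeeze_neg_le_half_siteEnergy hδ hsep i
      have h2 := le_abs_self e
      linarith
    have h1 : ∑ _i ∈ Ωᶜ, -(125 / 6 * δ⁻¹ ^ 6 + |e|) ≤
        ∑ i ∈ Ωᶜ, ((1 / 2 : ℝ) * siteEnergy lennardJones x i - e) :=
      Finset.sum_le_sum hlow
    rw [Finset.sum_const, nsmul_eq_mul] at h1
    have hB : 0 ≤ 125 / 6 * δ⁻¹ ^ 6 + |e| := by positivity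
    nlinarith [hcompl, hB]
  -- a charged site is a charged site of `Ω` or a shallow site
  have hsplit : ((Finset.univ.filter fun i => P i).card : ℝ) ≤
      ((Ω.filter fun i => P i).card : ℝ) + (Ωᶜ).card := by
    have hsub : (Finset.univ.filter fun i => P i) ⊆ (Ω.filter fun i => P i) ∪ Ωᶜ := by
      intro i hi
      by_cases hio : i ∈ Ω
      · exact Finset.mem_union_left _ (Finset.mem_filter.2 ⟨hio, (Finset.mem_filter.1 hi).2⟩)
      · exact Finset.mem_union_right _ (Finset.mem_compl.2 hio)
    calc ((Finset.univ.filter fun i => P i).card : ℝ)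
        ≤ (((Ω.filter fun i => P i) ∪ Ωᶜ).card : ℝ) := by
          exact_mod_cast Finset.card_le_card hsub
      _ ≤ _ := by exact_mod_cast Finset.card_union_le _ _
  have hΩN : (Ω.card : ℝ) ≤ N := by
    have := Finset.card_le_univ Ω
    rw [Fintype.card_fin] at this
    exact_mod_cast this
  have hCmax : C * ((Ω.filter fun i => ∃ j : Fin N, j ∉ Ω ∧ dist (x j) (x i) ≤ ρ).card : ℝ) ≤
      max C 0 * (M * (M * D.card)) :=
    calc C * ((Ω.filter fun i => ∃ j : Fin N, j ∉ Ω ∧ dist (x j) (x i) ≤ ρ).card : ℝ)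
        ≤ max C 0 * ((Ω.filter fun i => ∃ j : Fin N, j ∉ Ω ∧ dist (x j) (x i) ≤ ρ).card : ℝ) :=
          mul_le_mul_of_nonneg_right (le_max_left _ _) (by positivity)
      _ ≤ max C 0 * (M * (M * D.card)) := mul_le_mul_of_nonneg_left hbdry (le_max_right _ _)
  have hθN : θ * (Ω.card : ℝ) ≤ θ * N := mul_le_mul_of_nonneg_left hΩN hθ
  have h5 : c * ((Finset.univ.filter fun i => P i).card : ℝ) ≤
      c * ((Ω.filter fun i => P i).card : ℝ) + c * (M * D.card) := by
    have := mul_le_mul_of_nonneg_left hsplit hc.le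
    have := mul_le_mul_of_nonneg_left hcompl hc.le
    linarith
  have hfinal : c * ((Finset.univ.filter fun i => P i).card : ℝ) ≤
      (∑ i, ((1 / 2 : ℝ) * siteEnergy lennardJones x i - e)) + θ * N +
        ((125 / 6 * δ⁻¹ ^ 6 + |e|) * (M * D.card) + max C 0 * (M * (M * D.card)) +
          c * (M * D.card)) := by
    linarith
  calc c * ((Finset.univ.filter fun i => P i).card : ℝ) ≤ _ := hfinal
    _ = _ := by ring

/-- **The squeeze, per ground-state sequence and per predicate.** Suppose that for every separation `δ > 0`
the slack-coercivity inequality holds for the site predicate `P N x` of `δ`-separated configurations `x`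
(a charge `c > 0` independent of the slack `θ`; depth `ρ` and boundary constant `C` chosen after `θ`; `Ω`
ranging over finite sets of sites with `ρ`-deep crux-good neighbourhoods). Then along every sequence of
Lennard-Jones ground states whose defect fraction tends to `0`, the fraction of `P`-charged sites tends to `0`
(`θ` is sent to `0` AFTER `N → ∞`; minimality enters through the `o(N)` budget
`squeeze_tendsto_sum_excess_div` and the separation `LennardJonesMinimalDistance_holds`). -/
theorem gsqueeze_tendsto_card_div (P : (N : ℕ) → (Fin N → (EuclideanSpace ℝ (Fin 3))) → Fin N → Prop)
    [∀ (N : ℕ) (x : Fin N → (EuclideanSpace ℝ (Fin 3))), DecidablePred (P N x)]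
    (hcoer : ∀ δ : ℝ, 0 < δ → ∃ c : ℝ, 0 < c ∧ ∀ θ : ℝ, 0 < θ → ∃ ρ C : ℝ, 0 < ρ ∧
      ∀ (N : ℕ) (x : Fin N → (EuclideanSpace ℝ (Fin 3))), (∀ i j : Fin N, i ≠ j → δ ≤ dist (x i) (x j)) →
      ∀ Ω : Finset (Fin N), (∀ i ∈ Ω, ∀ j : Fin N, dist (x j) (x i) ≤ ρ → Good x j) →
        c * ((Ω.filter fun i => P N x i).card : ℝ)
            - C * ((Ω.filter fun i => ∃ j : Fin N, j ∉ Ω ∧ dist (x j) (x i) ≤ ρ).card : ℝ)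
            - θ * (Ω.card : ℝ)
          ≤ ∑ i ∈ Ω, ((1 / 2 : ℝ) * siteEnergy lennardJones x i -
              ⨅ Q : PeriodicConfiguration 3, Q.energyPerParticle lennardJones))
    (x : (N : ℕ) → (Fin N → (EuclideanSpace ℝ (Fin 3)))) (hgs : ∀ N, IsGroundState lennardJones (x N))
    (hdef : Tendsto (fun N : ℕ => (defects (x N) : ℝ) / N) atTop (𝓝 0)) :
    Tendsto (fun N : ℕ => ((Finset.univ.filter fun i => P N (x N) i).card : ℝ) / N) atTop (𝓝 0) := by
  obtain ⟨δ, hδ, hsepall⟩ := LennardJonesMinimalDistance_holds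
  obtain ⟨c, hc, hcθ⟩ := hcoer δ hδ
  have hbudget := squeeze_tendsto_sum_excess_div x hgs
  rw [Metric.tendsto_atTop]
  intro ε hε
  obtain ⟨ρ, C, hρ, hmain⟩ := hcθ (c * ε / 4) (by positivity)
  set K : ℝ := (2 * ρ / δ + 1) ^ 3 * (max C 0 * (2 * ρ / δ + 1) ^ 3 +
    (125 / 6 * δ⁻¹ ^ 6 + |ChargedEnergyGapNegative.eStar|) + c) with hK
  have h1 : ∀ᶠ N : ℕ in atTop, (∑ i, ((1 / 2 : ℝ) * siteEnergy lennardJones (x N) i -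
      ChargedEnergyGapNegative.eStar)) / N < c * ε / 4 :=
    hbudget.eventually_lt_const (by positivity)
  have h2 : ∀ᶠ N : ℕ in atTop, K * ((defects (x N) : ℝ) / N) < c * ε / 4 := by
    have h := hdef.const_mul K
    rw [mul_zero] at h
    exact h.eventually_lt_const (by positivity)
  obtain ⟨N₀, hN₀⟩ := eventually_atTop.1 (h1.and (h2.and (eventually_ge_atTop 1)))
  refine ⟨N₀, fun N hN => ?_⟩
  obtain ⟨hN1, hN2, hN3⟩ := hN₀ N hN
  have hsep := hsepall N (x N) (hgs N)
  have hmain' : ∀ Ω : Finset (Fin N), (∀ i ∈ Ω, ∀ j : Fin N, dist (x N j) (x N i) ≤ ρ → Good (x N) j) →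
      c * ((Ω.filter fun i => P N (x N) i).card : ℝ)
          - C * ((Ω.filter fun i => ∃ j : Fin N, j ∉ Ω ∧ dist (x N j) (x N i) ≤ ρ).card : ℝ)
          - (c * ε / 4) * (Ω.card : ℝ)
        ≤ ∑ i ∈ Ω, ((1 / 2 : ℝ) * siteEnergy lennardJones (x N) i - ChargedEnergyGapNegative.eStar) := by
    intro Ω hΩ
    have := hmain N (x N) hsep Ω hΩ
    rwa [squeeze_iInf_eq_eStar] at this
  have key := gsqueeze_ineq hδ hρ hc (by positivity : (0 : ℝ) ≤ c * ε / 4) (fun i => P N (x N) i) hsep hmain'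
  rw [← squeeze_defects_eq_card_filter] at key
  have hNpos : (0 : ℝ) < N := by exact_mod_cast hN3
  rw [Real.dist_eq, sub_zero, abs_of_nonneg (by positivity), div_lt_iff₀ hNpos]
  have hS : (∑ i, ((1 / 2 : ℝ) * siteEnergy lennardJones (x N) i -
      ChargedEnergyGapNegative.eStar)) < c * ε / 4 * N := by
    rwa [div_lt_iff₀ hNpos] at hN1
  have hD : K * (defects (x N) : ℝ) < c * ε / 4 * N := by
    rw [← mul_div_assoc, div_lt_iff₀ hNpos] at hN2
    exact hN2
  have hlt : c * ((Finset.univ.filter fun i => P N (x N) i).card : ℝ) < c * (ε * N) := by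
    have : K * (defects (x N) : ℝ) = (2 * ρ / δ + 1) ^ 3 * (max C 0 * (2 * ρ / δ + 1) ^ 3 +
        (125 / 6 * δ⁻¹ ^ 6 + |ChargedEnergyGapNegative.eStar|) + c) * (defects (x N) : ℝ) := by
      rw [hK]
    nlinarith
  exact lt_of_mul_lt_mul_left hlt hc.le

end Squeeze

/-! ## Clean centres (packing) -/

/-- **Clean centres exist eventually.** If along a sequence of Lennard-Jones ground states the fraction of
particles violating a site predicate `Q` tends to `0`, then for every radius `R'`, for all large `N`, some
particle has EVERY particle within `R'` of it satisfying `Q` (the sites within `R'` of a violating site are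
at most `(2R'/δ + 1)³` times the violating sites, `δ` the minimal distance of ground states). -/
theorem eventually_exists_clean_centre (Q : (N : ℕ) → (Fin N → (EuclideanSpace ℝ (Fin 3))) → Fin N → Prop)
    (x : (N : ℕ) → (Fin N → (EuclideanSpace ℝ (Fin 3)))) (hgs : ∀ N, IsGroundState lennardJones (x N))
    (hQ : Tendsto (fun N : ℕ =>
      ((Finset.univ.filter fun i => ¬ Q N (x N) i).card : ℝ) / N) atTop (𝓝 0))
    (R' : ℝ) :
    ∀ᶠ N : ℕ in atTop, ∃ i : Fin N, ∀ j : Fin N, dist (x N j) (x N i) ≤ R' → Q N (x N) j := by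
  obtain ⟨δ, hδ, hsepall⟩ := LennardJonesMinimalDistance_holds
  set R₀ : ℝ := max R' 0 with hR₀
  set M : ℝ := (2 * R₀ / δ + 1) ^ 3 with hM
  have hM0 : 0 < M := by positivity
  have hsumt : Tendsto (fun N : ℕ => M *
      (((Finset.univ.filter fun i => ¬ Q N (x N) i).card : ℝ) / N)) atTop (𝓝 0) := by
    have := hQ.const_mul M
    simpa using this
  have h1 : ∀ᶠ N : ℕ in atTop, M *
      (((Finset.univ.filter fun i => ¬ Q N (x N) i).card : ℝ) / N) < 1 :=
    hsumt.eventually_lt_const zero_lt_one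
  filter_upwards [h1, eventually_ge_atTop 1] with N hN1 hN3
  have hsep := hsepall N (x N) (hgs N)
  have hNpos : (0 : ℝ) < N := by exact_mod_cast hN3
  set Bad := Finset.univ.filter fun j : Fin N => ¬ Q N (x N) j with hBad
  set Blocked := Finset.univ.filter fun i : Fin N => ∃ j ∈ Bad, dist (x N j) (x N i) ≤ R₀ with hBl
  have hBl_le : (Blocked.card : ℝ) ≤ M * Bad.card :=
    squeeze_card_filter_exists_near_le hδ (le_max_right _ _) hsep Bad
  have hBl_lt : (Blocked.card : ℝ) < N := by
    have h2 : M * (Bad.card : ℝ) < N := by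
      have h3 := hN1
      rw [← mul_div_assoc, div_lt_iff₀ hNpos, one_mul] at h3
      exact h3
    linarith
  have hne : Blocked ≠ Finset.univ := by
    intro h
    rw [h, Finset.card_univ, Fintype.card_fin] at hBl_lt
    exact lt_irrefl _ hBl_lt
  obtain ⟨i, -, hi⟩ : ∃ i ∈ (Finset.univ : Finset (Fin N)), i ∉ Blocked := by
    by_contra h
    push Not at h
    exact hne (Finset.eq_univ_of_forall fun i => h i (Finset.mem_univ i))
  refine ⟨i, fun j hj => ?_⟩
  by_contra hbad
  apply hi
  refine Finset.mem_filter.2 ⟨Finset.mem_univ _, j, Finset.mem_filter.2 ⟨Finset.mem_univ _, hbad⟩, ?_⟩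
  exact hj.trans (le_max_left _ _)

/-! ## The laminar reading of a pinned window (`19/25 > 3/4`) -/

/-- The layers of a layered template are the horizontal planes `x₂ = z m`. -/
theorem layeredPos_apply_two (a : ℝ) (s : ℤ → ℤ) (z : ℤ → ℝ) (l : ℤ × ℤ × ℤ) :
    layeredPos a s z l 2 = z l.1 := by
  simp [layeredPos, triangularVec₁, triangularVec₂, barlowOffset, layerNormal]

/-- Heights with increments `≥ 19/25` grow at least linearly. -/
theorem add_mul_le_of_increments {z : ℤ → ℝ} (hz : ∀ m : ℤ, 19 / 25 ≤ z (m + 1) - z m) (m : ℤ) (n : ℕ) :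
    z m + 19 / 25 * n ≤ z (m + n) := by
  induction n with
  | zero => simp
  | succ n ih =>
    have h1 := hz (m + n)
    have e1 : m + ((n + 1 : ℕ) : ℤ) = m + (n : ℤ) + 1 := by push_cast; ring
    rw [e1]
    push_cast
    linarith

/-- **Pinned heights are `3/4`-separated** (`19/25 ≥ 3/4`). -/
theorem sep_of_increments {z : ℤ → ℝ} (hz : ∀ m : ℤ, 19 / 25 ≤ z (m + 1) - z m) {m m' : ℤ} (h : m ≠ m') :
    (3 : ℝ) / 4 ≤ |z m - z m'| := by
  wlog hlt : m < m' generalizing m m' with H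
  · have hlt' : m' < m := lt_of_le_of_ne (not_lt.1 hlt) (Ne.symm h)
    rw [abs_sub_comm]
    exact H (Ne.symm h) hlt'
  obtain ⟨n, hn⟩ := Int.le.dest (show m + 1 ≤ m' from hlt)
  have hgrow := add_mul_le_of_increments hz (m + 1) n
  rw [hn] at hgrow
  have h1 := hz m
  have hn0 : (0 : ℝ) ≤ n := Nat.cast_nonneg n
  rw [abs_sub_comm, abs_of_nonneg (by nlinarith)]
  nlinarith

/-- **A pinned matching is a laminar window.** If, after the translation `t`, every particle of the closed
`R`-ball of `x i` is within `ε` of a rigid image `A (layeredPos a s z ·)` of a layered template whose height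
increments are all `≥ 19/25`, then — read through the inverse rotation — every particle within `R` of `x i` lies
within `ε`, in the third coordinate, of the `3/4`-separated height set `{z m − c₀ : m ∈ ℤ}`: the one-window
laminarity clause of the crux `LjLaminarWindows` at `(L, η) = (R, ε)`. -/
theorem laminar_of_pinnedMatching {N : ℕ} {x : Fin N → (EuclideanSpace ℝ (Fin 3))} {i : Fin N} {R ε : ℝ}
    {A : (EuclideanSpace ℝ (Fin 3)) →ₗᵢ[ℝ] (EuclideanSpace ℝ (Fin 3))} {t : (EuclideanSpace ℝ (Fin 3))} {a : ℝ} {s : ℤ → ℤ} {z : ℤ → ℝ}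
    (hz : ∀ m : ℤ, 19 / 25 ≤ z (m + 1) - z m)
    (h1 : ∀ j : Fin N, dist (x j) (x i) ≤ R → ∃ l : ℤ × ℤ × ℤ, dist (x j + t) (A (layeredPos a s z l)) ≤ ε) :
    ∃ (A' : (EuclideanSpace ℝ (Fin 3)) →ₗᵢ[ℝ] (EuclideanSpace ℝ (Fin 3))) (T : Set ℝ),
      (∀ t ∈ T, ∀ t' ∈ T, t ≠ t' → (3 : ℝ) / 4 ≤ |t - t'|) ∧
      (∀ j : Fin N, dist (x j) (x i) ≤ R → ∃ t ∈ T, |(A' (x j - x i)) 2 - t| ≤ ε) := by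
  -- the inverse rotation `B.symm`, `B` the equivalence underlying `A`
  set B : (EuclideanSpace ℝ (Fin 3)) ≃ₗᵢ[ℝ] (EuclideanSpace ℝ (Fin 3)) := A.toLinearIsometryEquiv rfl with hB
  have hBA : ∀ v : (EuclideanSpace ℝ (Fin 3)), B.symm (A v) = v := fun v => by
    have : A v = B v := (LinearIsometry.toLinearIsometryEquiv_apply A rfl v).symm
    rw [this, LinearIsometryEquiv.symm_apply_apply]
  set c₀ : ℝ := (B.symm (x i + t)) 2 with hc₀
  refine ⟨B.symm.toLinearIsometry, Set.range fun m : ℤ => z m - c₀, ?_, ?_⟩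
  · rintro _ ⟨m, rfl⟩ _ ⟨m', rfl⟩ hne
    have hmm' : m ≠ m' := fun hm => hne (by simp [hm])
    have hsep := sep_of_increments hz hmm'
    have e : z m - c₀ - (z m' - c₀) = z m - z m' := by ring
    rwa [e]
  · intro j hj
    obtain ⟨l, hl⟩ := h1 j hj
    refine ⟨z l.1 - c₀, ⟨l.1, rfl⟩, ?_⟩
    have hd : dist (B.symm (x j + t)) (layeredPos a s z l) ≤ ε := by
      have e := B.symm.dist_map (x j + t) (A (layeredPos a s z l))
      rw [hBA] at e
      rw [e]
      exact hl
    have hcoord : |(B.symm (x j + t)) 2 - z l.1| ≤ ε := by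
      have e := PiLp.dist_apply_le (B.symm (x j + t)) (layeredPos a s z l) 2
      rw [layeredPos_apply_two, Real.dist_eq] at e
      exact e.trans hd
    have e2 : (B.symm.toLinearIsometry (x j - x i)) 2 = (B.symm (x j + t)) 2 - c₀ := by
      have e3 : x j - x i = (x j + t) - (x i + t) := by abel
      rw [hc₀, LinearIsometryEquiv.coe_toLinearIsometry, e3, map_sub, PiLp.sub_apply]
    rw [e2]
    have e4 : (B.symm (x j + t)) 2 - c₀ - (z l.1 - c₀) = (B.symm (x j + t)) 2 - z l.1 := by ring
    rwa [e4]

/-- Landing anchor of this glue file (registered sub-goal of crux stmt-AtomisticToContinuum-6711, line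
`stacking-blind-budget-flatness`; re-exports `sep_of_increments`): layer heights with increments `≥ 19/25` are
`3/4`-separated. -/
theorem pinnedSqueeze_anchor :
    ∀ z : ℤ → ℝ, (∀ m : ℤ, 19 / 25 ≤ z (m + 1) - z m) → ∀ m m' : ℤ, m ≠ m' → (3 : ℝ) / 4 ≤ |z m - z m'| :=
  fun _ hz _ _ h => sep_of_increments hz h

end Summit.AtomisticToContinuum.Crystallization.Theorems.StackingBlindBudgetFlatness

end
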